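import Mathlib
import Literature.Analysis.ODE.RegularSingularSharpRadius
import HarnessLib

/-!
# Frobenius series as CERTIFIED VALUES: truncation enclosures, and the jet majorant with the resolvent factor only
# beyond the jet

Topic `Literature/Analysis/ODE` (namespace `Literature.Analysis.ODE`). Companion of `RegularSingularAnalyticBranch*.lean`,
`RegularSingularScalarSystem.lean`, `RegularSingularSharpRadius.lean`. Those files deliver the analytic / logarithmic
Frobenius branches `Σ xⁿ • vₙ` of `x v′ = M(x) v + g(x)` with explicit geometric coefficient bounds `‖vₙ‖ ≤ B μⁿ`. A
certificate that MATCHES such a branch against another solution (two-point connection problems: the tearing index `Δ′`,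
Newcomb's zero-exclusion criterion) needs the branch as a NUMBER at a point `x` of the disc `μ‖x‖ < 1`: an exactly
evaluated partial sum plus a certified tail. This file supplies the elementary estimates of Weierstrass's method of analytic continuation by
power series as analysed by Henrici [cite: Henrici1974, §3.6 «Numerical analytic continuation along an arc», eqs.
(3.6-10)–(3.6-13)] and of the majorant method at a singularity of the first kind [cite: CoddingtonLevinson1955, Ch. 4 §3]:

* `norm_tsum_pow_smul_sub_sum_le` — THE TAIL: `‖Σ' xⁿ • wₙ − Σ_{n<N} xⁿ • wₙ‖ ≤ B (λ‖x‖)^N / (1 − λ‖x‖)`; the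
  componentwise forms `norm_fst_tsum_pow_smul_sub_sum_le`, `norm_snd_tsum_pow_smul_sub_sum_le` on `𝕜 × 𝕜` (the shape
  of `frobeniusSol (scalarSysM …)`: first component = the solution, second = its derivative part);
* `norm_frobeniusCoeff_le_of_jet'` — the SHARP MAJORANT FROM A JET of `RegularSingularSharpRadius.lean` with the resolvent
  bound `‖Rₙ‖ ≤ c/n` required only for `n ≥ N` (beyond the checked jet), so that `c` may be taken close to its limit
  (`c = 1 + ‖q₀‖/N` for the scalar system with `p₀ = 0`, instead of `1 + ‖q₀‖`): the threshold
  `c (K B a/(μ − a) + G) ≤ N B` then closes with a much shorter jet;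
* `norm_scalarSysR_le_sharp` — `‖Rₙ‖ ≤ (1 + ‖q₀‖/n)/n` for the scalar system whenever `‖n + p₀‖ ≥ n` (e.g. `p₀` real
  and `≥ 0`), and `norm_scalarSysR_le_of_le` — hence `‖Rₙ‖ ≤ (1 + ‖q₀‖/N)/n` for `n ≥ N`.

Written for LADDER-GRIDFUSION rung F3.r3 (the cylindrical `Δ′` certificate: patch, axis and outer series are all
evaluated this way), but free of any instance data.
-/

noncomputable section

open Finset Filter Metric
open scoped Topology

namespace Literature.Analysis.ODE

variable {𝕜 : Type*} [RCLike 𝕜]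

/-! ### Truncation: the value of a geometrically majorised series from a partial sum -/

section Truncation

variable {F : Type*} [NormedAddCommGroup F] [NormedSpace 𝕜 F] [CompleteSpace F]

/-- **THE TAIL ESTIMATE** of Weierstrass–Henrici numerical analytic continuation: if `‖wₙ‖ ≤ B λⁿ` (Cauchy's
coefficient estimate, `λ = 1/τ`) and `λ‖x‖ < 1` then `‖Σ' xⁿ • wₙ − Σ_{n<N} xⁿ • wₙ‖ ≤ B (λ‖x‖)^N / (1 − λ‖x‖)` — the
`m = 0` component of Henrici's remainder majorisation. [cite: Henrici1974, §3.6 eqs. (3.6-10)–(3.6-13)] -/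
theorem norm_tsum_pow_smul_sub_sum_le {w : ℕ → F} {B lam : ℝ} (hw : ∀ n, ‖w n‖ ≤ B * lam ^ n) (hlam : 0 ≤ lam)
    {x : 𝕜} (hx : lam * ‖x‖ < 1) (N : ℕ) :
    ‖(∑' n, x ^ n • w n) - ∑ n ∈ range N, x ^ n • w n‖ ≤ B * (lam * ‖x‖) ^ N / (1 - lam * ‖x‖) := by
  have h0 : 0 ≤ lam * ‖x‖ := by positivity
  have hB : 0 ≤ B := le_trans (norm_nonneg _) ((hw 0).trans (by simp))
  have hs : Summable fun n => x ^ n • w n := (summable_norm_pow_smul hw hlam hx).of_norm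
  have htail : (∑' n, x ^ n • w n) - ∑ n ∈ range N, x ^ n • w n = ∑' n, x ^ (n + N) • w (n + N) := by
    rw [← hs.sum_add_tsum_nat_add N]
    abel
  rw [htail, div_eq_mul_inv]
  refine tsum_of_norm_bounded ((hasSum_geometric_of_lt_one h0 hx).mul_left (B * (lam * ‖x‖) ^ N)) fun n => ?_
  rw [norm_smul, norm_pow]
  calc ‖x‖ ^ (n + N) * ‖w (n + N)‖ ≤ ‖x‖ ^ (n + N) * (B * lam ^ (n + N)) :=
        mul_le_mul_of_nonneg_left (hw _) (by positivity)
    _ = B * (lam * ‖x‖) ^ N * (lam * ‖x‖) ^ n := by ring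

variable {w : ℕ → 𝕜 × 𝕜} {B lam : ℝ} {x : 𝕜}

/-- First component of the tail estimate on `𝕜 × 𝕜` (vector-valued continuation, Henrici's norm (3.6) is the
row-max norm): `‖(Σ' xⁿ • wₙ).1 − Σ_{n<N} xⁿ (wₙ).1‖ ≤ B (λ‖x‖)^N/(1 − λ‖x‖)`.
[cite: Henrici1974, §3.6 eqs. (3.6-10)–(3.6-13)] -/
theorem norm_fst_tsum_pow_smul_sub_sum_le (hw : ∀ n, ‖w n‖ ≤ B * lam ^ n) (hlam : 0 ≤ lam) (hx : lam * ‖x‖ < 1)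
    (N : ℕ) :
    ‖(∑' n, x ^ n • w n).1 - ∑ n ∈ range N, x ^ n * (w n).1‖ ≤ B * (lam * ‖x‖) ^ N / (1 - lam * ‖x‖) := by
  have h := norm_tsum_pow_smul_sub_sum_le hw hlam hx N
  have e : (∑' n, x ^ n • w n).1 - ∑ n ∈ range N, x ^ n * (w n).1 =
      ((∑' n, x ^ n • w n) - ∑ n ∈ range N, x ^ n • w n).1 := by
    rw [Prod.fst_sub, Prod.fst_sum]
    simp only [Prod.smul_fst, smul_eq_mul]
  rw [e]
  exact (norm_fst_le _).trans h

/-- Second component of the tail estimate on `𝕜 × 𝕜`: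
`‖(Σ' xⁿ • wₙ).2 − Σ_{n<N} xⁿ (wₙ).2‖ ≤ B (λ‖x‖)^N/(1 − λ‖x‖)`. [cite: Henrici1974, §3.6 eqs. (3.6-10)–(3.6-13)] -/
theorem norm_snd_tsum_pow_smul_sub_sum_le (hw : ∀ n, ‖w n‖ ≤ B * lam ^ n) (hlam : 0 ≤ lam) (hx : lam * ‖x‖ < 1)
    (N : ℕ) :
    ‖(∑' n, x ^ n • w n).2 - ∑ n ∈ range N, x ^ n * (w n).2‖ ≤ B * (lam * ‖x‖) ^ N / (1 - lam * ‖x‖) := by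
  have h := norm_tsum_pow_smul_sub_sum_le hw hlam hx N
  have e : (∑' n, x ^ n • w n).2 - ∑ n ∈ range N, x ^ n * (w n).2 =
      ((∑' n, x ^ n • w n) - ∑ n ∈ range N, x ^ n • w n).2 := by
    rw [Prod.snd_sub, Prod.snd_sum]
    simp only [Prod.smul_snd, smul_eq_mul]
  rw [e]
  exact (norm_snd_le _).trans h

end Truncation

/-! ### The jet majorant with the resolvent factor only beyond the jet -/

section Jet

variable {E : Type*} [NormedAddCommGroup E] [NormedSpace 𝕜 E]

/-- **SHARP MAJORANT FROM A JET, resolvent bound only beyond the jet.** As `norm_frobeniusCoeff_le_of_jet`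
(`‖Mₖ‖ ≤ K aᵏ`, `‖gₖ‖ ≤ G aᵏ` for `k ≥ 1`; any rate `μ > a`; `B ≥ ‖v₀‖`; the jet `‖vₙ‖ ≤ B μⁿ` for `n < N`; threshold
`c (K B a/(μ − a) + G) ≤ N B`), but the resolvent estimate `‖Rₙ‖ ≤ c/n` is required only for `n ≥ N`: the induction
uses it only there. For the scalar system this lets `c ↓ 1` as `N` grows (`norm_scalarSysR_le_of_le`), which shortens
the jet a certificate has to check. [cite: CoddingtonLevinson1955, Ch. 4 §3] -/
theorem norm_frobeniusCoeff_le_of_jet' {M : ℕ → E →L[𝕜] E} {g : ℕ → E} {R : ℕ → E →L[𝕜] E} {v₀ : E}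
    {a K G c μ B : ℝ} {N : ℕ} (ha : 0 ≤ a) (hK : 0 ≤ K) (hG : 0 ≤ G) (hc : 0 ≤ c)
    (hM : ∀ k : ℕ, 1 ≤ k → ‖M k‖ ≤ K * a ^ k) (hg : ∀ k : ℕ, 1 ≤ k → ‖g k‖ ≤ G * a ^ k)
    (hRn : ∀ n : ℕ, N ≤ n → 1 ≤ n → ‖R n‖ ≤ c / n) (hμ : a < μ) (hB₀ : ‖v₀‖ ≤ B)
    (hjet : ∀ n : ℕ, n < N → ‖frobeniusCoeff M g R v₀ n‖ ≤ B * μ ^ n)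
    (hN : c * (K * B * a / (μ - a) + G) ≤ N * B) (n : ℕ) :
    ‖frobeniusCoeff M g R v₀ n‖ ≤ B * μ ^ n := by
  have hB : 0 ≤ B := (norm_nonneg _).trans hB₀
  have hμ0 : 0 ≤ μ := ha.trans hμ.le
  have hμa : 0 < μ - a := sub_pos.2 hμ
  induction n using Nat.strong_induction_on with | _ n ih => ?_
  rcases lt_or_ge n N with hn | hn
  · exact hjet n hn
  rcases Nat.eq_zero_or_pos n with rfl | hn1
  · simpa using hB₀
  have hn0 : (0 : ℝ) < n := by exact_mod_cast hn1
  set S := ∑ k ∈ range n, a ^ (n - k) * μ ^ k with hS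
  have hS0 : 0 ≤ S := Finset.sum_nonneg fun k _ => by positivity
  have hSle : S ≤ a * μ ^ n / (μ - a) := by
    rw [le_div_iff₀ hμa, mul_comm]
    have key := jet_majorant_telescope a μ n
    rw [key]
    nlinarith [pow_nonneg ha n]
  have hsum : ‖∑ k ∈ range n, M (n - k) (frobeniusCoeff M g R v₀ k)‖ ≤ K * B * S := by
    calc ‖∑ k ∈ range n, M (n - k) (frobeniusCoeff M g R v₀ k)‖
        ≤ ∑ k ∈ range n, ‖M (n - k) (frobeniusCoeff M g R v₀ k)‖ := norm_sum_le _ _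
      _ ≤ ∑ k ∈ range n, K * a ^ (n - k) * (B * μ ^ k) := by
          refine Finset.sum_le_sum fun k hk => ?_
          have hk := mem_range.1 hk
          calc ‖M (n - k) (frobeniusCoeff M g R v₀ k)‖ ≤ ‖M (n - k)‖ * ‖frobeniusCoeff M g R v₀ k‖ :=
                (M (n - k)).le_opNorm _
            _ ≤ K * a ^ (n - k) * (B * μ ^ k) :=
                mul_le_mul (hM _ (by omega)) (ih k hk) (norm_nonneg _) (by positivity)
      _ = K * B * S := by
          rw [hS, Finset.mul_sum]
          exact Finset.sum_congr rfl fun k _ => by ring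
  have han : a ^ n ≤ μ ^ n := pow_le_pow_left₀ ha hμ.le n
  calc ‖frobeniusCoeff M g R v₀ n‖
      = ‖R n (∑ k ∈ range n, M (n - k) (frobeniusCoeff M g R v₀ k) + g n)‖ := by
        rw [frobeniusCoeff_of_ne_zero M g R v₀ hn1.ne']
    _ ≤ ‖R n‖ * ‖∑ k ∈ range n, M (n - k) (frobeniusCoeff M g R v₀ k) + g n‖ := (R n).le_opNorm _
    _ ≤ c / n * (K * B * S + G * a ^ n) :=
        mul_le_mul (hRn n hn hn1) ((norm_add_le _ _).trans (add_le_add hsum (hg n hn1))) (norm_nonneg _)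
          (by positivity)
    _ ≤ c / n * (K * B * (a * μ ^ n / (μ - a)) + G * μ ^ n) := by
        refine mul_le_mul_of_nonneg_left (add_le_add (mul_le_mul_of_nonneg_left hSle (by positivity))
          (mul_le_mul_of_nonneg_left han hG)) (by positivity)
    _ = (c * (K * B * a / (μ - a) + G)) / n * μ ^ n := by
        field_simp
    _ ≤ (N * B) / n * μ ^ n := by
        refine mul_le_mul_of_nonneg_right (div_le_div_of_nonneg_right hN hn0.le) (by positivity)
    _ ≤ B * μ ^ n := by
        refine mul_le_mul_of_nonneg_right ?_ (by positivity)
        rw [div_le_iff₀ hn0]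
        have : (N : ℝ) ≤ n := by exact_mod_cast hn
        nlinarith

end Jet

/-! ### The scalar resolvent, sharp form -/

section Resolvent

variable (pc qc : ℕ → 𝕜)

/-- **SHARP RESOLVENT BOUND.** If `‖n + p₀‖ ≥ n` (`n ≥ 1`; e.g. `p₀` real and non-negative — in particular the
resonant case `p₀ = 0` and the axis equations with `p₀ > 0`), then `‖Rₙ‖ ≤ (1 + ‖q₀‖/n)/n`: the resolvent factor tends
to `1/n`. [cite: CoddingtonLevinson1955, Ch. 4 §3] -/
theorem norm_scalarSysR_le_sharp {n : ℕ} (hn : 1 ≤ n) (hres : (n : ℝ) ≤ ‖(n : 𝕜) + pc 0‖) :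
    ‖scalarSysR pc qc n‖ ≤ (1 + ‖qc 0‖ / n) / n := by
  have hn0 : (0 : ℝ) < n := by exact_mod_cast hn
  have hP : 0 < ‖(n : 𝕜) + pc 0‖ := lt_of_lt_of_le hn0 hres
  refine ContinuousLinearMap.opNorm_le_bound _ (by positivity) fun w => ?_
  rw [scalarSysR_apply, Prod.norm_mk]
  have hw1 : ‖w.1‖ ≤ ‖w‖ := norm_fst_le w
  have hw2 : ‖w.2‖ ≤ ‖w‖ := norm_snd_le w
  have hw0 : 0 ≤ ‖w‖ := norm_nonneg w
  have hq0 : 0 ≤ ‖qc 0‖ := norm_nonneg _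
  refine max_le ?_ ?_
  · rw [norm_mul, norm_inv, RCLike.norm_natCast]
    calc (n : ℝ)⁻¹ * ‖w.1‖ ≤ (n : ℝ)⁻¹ * ‖w‖ := mul_le_mul_of_nonneg_left hw1 (by positivity)
      _ = 1 / n * ‖w‖ := by ring
      _ ≤ (1 + ‖qc 0‖ / n) / n * ‖w‖ := by
          refine mul_le_mul_of_nonneg_right (div_le_div_of_nonneg_right ?_ hn0.le) hw0
          have : 0 ≤ ‖qc 0‖ / n := by positivity
          linarith
  · rw [norm_mul, norm_inv, norm_mul, RCLike.norm_natCast]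
    have hnum : ‖-(qc 0) * w.1 + (n : 𝕜) * w.2‖ ≤ (‖qc 0‖ + n) * ‖w‖ := by
      calc ‖-(qc 0) * w.1 + (n : 𝕜) * w.2‖ ≤ ‖-(qc 0) * w.1‖ + ‖(n : 𝕜) * w.2‖ := norm_add_le _ _
        _ = ‖qc 0‖ * ‖w.1‖ + n * ‖w.2‖ := by rw [norm_mul, norm_neg, norm_mul, RCLike.norm_natCast]
        _ ≤ ‖qc 0‖ * ‖w‖ + n * ‖w‖ := add_le_add (mul_le_mul_of_nonneg_left hw1 hq0)
            (mul_le_mul_of_nonneg_left hw2 hn0.le)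
        _ = (‖qc 0‖ + n) * ‖w‖ := by ring
    calc ((n : ℝ) * ‖(n : 𝕜) + pc 0‖)⁻¹ * ‖-(qc 0) * w.1 + (n : 𝕜) * w.2‖
        ≤ ((n : ℝ) * n)⁻¹ * ((‖qc 0‖ + n) * ‖w‖) := by
          refine mul_le_mul ?_ hnum (norm_nonneg _) (by positivity)
          exact inv_anti₀ (by positivity) (mul_le_mul_of_nonneg_left hres hn0.le)
      _ = (1 + ‖qc 0‖ / n) / n * ‖w‖ := by
          field_simp
          ring

/-- Beyond an index `N ≥ 1` the resolvent factor is at most `(1 + ‖q₀‖/N)/n`: the constant `c` of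
`norm_frobeniusCoeff_le_of_jet'`. [cite: CoddingtonLevinson1955, Ch. 4 §3] -/
theorem norm_scalarSysR_le_of_le {N n : ℕ} (hN : 1 ≤ N) (hn : N ≤ n) (hres : (n : ℝ) ≤ ‖(n : 𝕜) + pc 0‖) :
    ‖scalarSysR pc qc n‖ ≤ (1 + ‖qc 0‖ / N) / n := by
  have hn1 : 1 ≤ n := hN.trans hn
  have hn0 : (0 : ℝ) < n := by exact_mod_cast hn1
  have hN0 : (0 : ℝ) < N := by exact_mod_cast hN
  refine (norm_scalarSysR_le_sharp pc qc hn1 hres).trans (div_le_div_of_nonneg_right ?_ hn0.le)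
  have hNn : (N : ℝ) ≤ n := by exact_mod_cast hn
  have : ‖qc 0‖ / n ≤ ‖qc 0‖ / N := div_le_div_of_nonneg_left (norm_nonneg _) hN0 hNn
  linarith

end Resolvent

end Literature.Analysis.ODE

end
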